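import Mathlib
import Summits.KontsevichZagierPeriods.KontsevichZagierPeriods.Theorems.SoloInformedPellAbelBand
import HarnessLib
import HarnessLib.Audit

/-!
# Kummer family VII: the order-three torsion law for the third kind, I — algebra (s41)

COROLLARY XXIX.7 of the residency paper (§6quindecies), file I of two.  The hyperbolic torsion
points of ORDER THREE of the Kummer family `Π(n | m)` (`n = m·sn²(K/3 | m)`, i.e. `x = sn(K/3)`
solves `mx⁴ − 2mx³ + 2x − 1 = 0`) form a RATIONAL curve: with `x = 2y²/(1+y²)`, `1/3 < y² < 1`,

  `m(y) = (y²+1)³(3y²−1)/(16y⁶)`,  `n(y) = (y²+1)(3y²−1)/(4y²)`,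

and the Pell–Abel unit is `A + B√Δ` with `A = (1 − mt²)(1 + at²)`, `a = (3y²−1)/2`, `B = bt`,
`b = (3y²+1)(3y²−1)/(4y³)`:

  `A² − B²Δ = (1 − mt²)(1 − nt²)³`,  `2(AB′ − A′B)Δ + ABΔ′ = (q₀ + q₂t²)(1 − mt²)(1 − nt²)²`,

`q₀ = 2b`, `q₂ = −b(y²+1)/y²`, so that `α = q₂/(q₂ + nq₀) = 2/(3(1 − y²))`.  This file proves the
identities (`field_simp; ring`), the positivity facts on the parameter range, algebraicity and
semialgebraicity; file II assembles the Pell–Abel datum and applies THEOREM XXX.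

References: N. H. Abel (1826); M. Kontsevich, D. Zagier, *Periods* (2001), §1.2; this work.
-/

noncomputable section

open MeasureTheory Set Filter
open scoped Classical

open Literature.NumberTheory.Transcendental Literature.NumberTheory.Transcendental.KZ
open Literature.ModelTheory.ExponentialFields

namespace Summit.KontsevichZagierPeriods.KontsevichZagierPeriods.Theorems

/-! ### The order-three data -/

/-- The modulus `m(y) = (y²+1)³(3y²−1)/(16y⁶)` of the order-three fibre. [this work] -/
def soloInformedT3m (y : ℝ) : ℝ := (y ^ 2 + 1) ^ 3 * (3 * y ^ 2 - 1) / (16 * y ^ 6)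

/-- The parameter `n(y) = (y²+1)(3y²−1)/(4y²) = m·sn²(K/3 | m)`. [this work] -/
def soloInformedT3n (y : ℝ) : ℝ := (y ^ 2 + 1) * (3 * y ^ 2 - 1) / (4 * y ^ 2)

/-- `a(y) = (3y²−1)/2`. [this work] -/
def soloInformedT3a (y : ℝ) : ℝ := (3 * y ^ 2 - 1) / 2

/-- `b(y) = (3y²+1)(3y²−1)/(4y³)`. [this work] -/
def soloInformedT3b (y : ℝ) : ℝ := (3 * y ^ 2 + 1) * (3 * y ^ 2 - 1) / (4 * y ^ 3)

/-- `A(y,t) = (1 − mt²)(1 + at²)`. [this work] -/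
def soloInformedT3A (y t : ℝ) : ℝ := (1 - soloInformedT3m y * t ^ 2) * (1 + soloInformedT3a y * t ^ 2)

/-- `B(y,t) = bt`. [this work] -/
def soloInformedT3B (y t : ℝ) : ℝ := soloInformedT3b y * t

/-- `q₀(y) = 2b`. [this work] -/
def soloInformedT3q0 (y : ℝ) : ℝ := (3 * y ^ 2 + 1) * (3 * y ^ 2 - 1) / (2 * y ^ 3)

/-- `q₂(y) = −b(y²+1)/y²`. [this work] -/
def soloInformedT3q2 (y : ℝ) : ℝ := -((y ^ 2 + 1) * (3 * y ^ 2 + 1) * (3 * y ^ 2 - 1)) / (4 * y ^ 5)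

/-- The algebraic ratio `α(y) = Π/K = 2/(3(1 − y²))`. [this work] -/
def soloInformedT3alpha (y : ℝ) : ℝ := 2 / (3 * (1 - y ^ 2))

/-! ### The polynomial identities -/

/-- **Pell–Abel norm identity** `A² − B²Δ = (1−mt²)(1−nt²)²·(1−nt²)`. [this work] -/
theorem soloInformed_t3_norm {y : ℝ} (hy : y ≠ 0) (t : ℝ) :
    soloInformedT3A y t ^ 2 - soloInformedT3B y t ^ 2 * ((1 - t ^ 2) * (1 - soloInformedT3m y * t ^ 2)) =
      (1 - soloInformedT3m y * t ^ 2) * (1 - soloInformedT3n y * t ^ 2) ^ 2 *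
        (1 - soloInformedT3n y * t ^ 2) := by
  unfold soloInformedT3A soloInformedT3B soloInformedT3m soloInformedT3n soloInformedT3a soloInformedT3b
  field_simp
  ring

/-- **The logarithmic derivative of the unit**: `2(AB′ − A′B)Δ + ABΔ′ = (q₀+q₂t²)(1−mt²)(1−nt²)²`,
with `A′, B′, Δ′` written as the product rule delivers them. [this work] -/
theorem soloInformed_t3_numerator {y : ℝ} (hy : y ≠ 0) (t : ℝ) :
    2 * (soloInformedT3A y t * (soloInformedT3b y * 1) -
        (-(soloInformedT3m y * (2 * t)) * (1 + soloInformedT3a y * t ^ 2) +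
          (1 - soloInformedT3m y * t ^ 2) * (soloInformedT3a y * (2 * t))) * soloInformedT3B y t) *
        ((1 - t ^ 2) * (1 - soloInformedT3m y * t ^ 2)) +
      soloInformedT3A y t * soloInformedT3B y t *
        (-(2 * t) * (1 - soloInformedT3m y * t ^ 2) + (1 - t ^ 2) * (-(soloInformedT3m y * (2 * t)))) =
      (soloInformedT3q0 y + soloInformedT3q2 y * t ^ 2) *
        ((1 - soloInformedT3m y * t ^ 2) * (1 - soloInformedT3n y * t ^ 2) ^ 2) := by
  unfold soloInformedT3A soloInformedT3B soloInformedT3m soloInformedT3n soloInformedT3a soloInformedT3b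
    soloInformedT3q0 soloInformedT3q2
  field_simp
  ring

/-- `q₂ + nq₀ = −3(1−y²)(y²+1)(3y²−1)(3y²+1)/(8y⁵)`. [this work] -/
theorem soloInformed_t3_res_eq {y : ℝ} (hy : y ≠ 0) :
    soloInformedT3q2 y + soloInformedT3n y * soloInformedT3q0 y =
      -(3 * (1 - y ^ 2) * (y ^ 2 + 1) * (3 * y ^ 2 - 1) * (3 * y ^ 2 + 1)) / (8 * y ^ 5) := by
  unfold soloInformedT3q2 soloInformedT3n soloInformedT3q0
  field_simp
  ring

/-- `1 − m(y) = (1−y²)³(3y²+1)/(16y⁶)`. [this work] -/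
theorem soloInformed_t3_one_sub_m {y : ℝ} (hy : y ≠ 0) :
    1 - soloInformedT3m y = (1 - y ^ 2) ^ 3 * (3 * y ^ 2 + 1) / (16 * y ^ 6) := by
  unfold soloInformedT3m
  field_simp
  ring

/-- `1 − n(y) = (1−y²)(3y²+1)/(4y²)`. [this work] -/
theorem soloInformed_t3_one_sub_n {y : ℝ} (hy : y ≠ 0) :
    1 - soloInformedT3n y = (1 - y ^ 2) * (3 * y ^ 2 + 1) / (4 * y ^ 2) := by
  unfold soloInformedT3n
  field_simp
  ring

/-! ### Positivity on the parameter range `1/3 < y² < 1` -/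

/-- `m(y) ∈ (0,1)`. [this work] -/
theorem soloInformed_t3_m_mem {y : ℝ} (hy : 1 < 3 * y ^ 2) (hy' : y ^ 2 < 1) :
    soloInformedT3m y ∈ Ioo (0:ℝ) 1 := by
  have hy0 : y ≠ 0 := by rintro rfl; norm_num at hy
  have h6 : 0 < y ^ 6 := by positivity
  refine ⟨?_, ?_⟩
  · unfold soloInformedT3m
    exact div_pos (mul_pos (by positivity) (by linarith)) (by positivity)
  · have h := soloInformed_t3_one_sub_m hy0
    have : 0 < (1 - y ^ 2) ^ 3 * (3 * y ^ 2 + 1) / (16 * y ^ 6) :=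
      div_pos (mul_pos (pow_pos (by linarith) 3) (by positivity)) (by positivity)
    linarith

/-- `n(y) ∈ (0,1)`. [this work] -/
theorem soloInformed_t3_n_mem {y : ℝ} (hy : 1 < 3 * y ^ 2) (hy' : y ^ 2 < 1) :
    soloInformedT3n y ∈ Ioo (0:ℝ) 1 := by
  have hy0 : y ≠ 0 := by rintro rfl; norm_num at hy
  refine ⟨?_, ?_⟩
  · unfold soloInformedT3n
    exact div_pos (mul_pos (by positivity) (by linarith)) (by positivity)
  · have h := soloInformed_t3_one_sub_n hy0
    have : 0 < (1 - y ^ 2) * (3 * y ^ 2 + 1) / (4 * y ^ 2) :=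
      div_pos (mul_pos (by linarith) (by positivity)) (by positivity)
    linarith

/-- `0 < A(y,t)` for `t² ≤ 1`. [this work] -/
theorem soloInformed_t3_A_pos {y t : ℝ} (hy : 1 < 3 * y ^ 2) (hy' : y ^ 2 < 1) (ht : t ^ 2 ≤ 1) :
    0 < soloInformedT3A y t := by
  have hm := soloInformed_t3_m_mem hy hy'
  have ha : 0 < soloInformedT3a y := by unfold soloInformedT3a; linarith
  have h1 := mul_le_of_le_one_right hm.1.le ht
  unfold soloInformedT3A
  exact mul_pos (by linarith [hm.2]) (by positivity)

/-- `0 < R(y,t) = (1−mt²)(1−nt²)²` for `t² ≤ 1`. [this work] -/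
theorem soloInformed_t3_R_pos {y t : ℝ} (hy : 1 < 3 * y ^ 2) (hy' : y ^ 2 < 1) (ht : t ^ 2 ≤ 1) :
    0 < (1 - soloInformedT3m y * t ^ 2) * (1 - soloInformedT3n y * t ^ 2) ^ 2 := by
  have hm := soloInformed_t3_m_mem hy hy'
  have hn := soloInformed_t3_n_mem hy hy'
  have h1 := mul_le_of_le_one_right hm.1.le ht
  have h2 := mul_le_of_le_one_right hn.1.le ht
  exact mul_pos (by linarith [hm.2]) (pow_pos (by linarith [hn.2]) 2)

/-- The residue condition `q₂ + nq₀ ≠ 0`. [this work] -/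
theorem soloInformed_t3_res {y : ℝ} (hy : 1 < 3 * y ^ 2) (hy' : y ^ 2 < 1) :
    soloInformedT3q2 y + soloInformedT3n y * soloInformedT3q0 y ≠ 0 := by
  have hy0 : y ≠ 0 := by rintro rfl; norm_num at hy
  rw [soloInformed_t3_res_eq hy0]
  have h : 0 < 3 * (1 - y ^ 2) * (y ^ 2 + 1) * (3 * y ^ 2 - 1) * (3 * y ^ 2 + 1) :=
    mul_pos (mul_pos (mul_pos (by linarith) (by positivity)) (by linarith)) (by positivity)
  have h5 : (8 : ℝ) * y ^ 5 ≠ 0 := mul_ne_zero (by norm_num) (pow_ne_zero 5 hy0)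
  exact div_ne_zero (by linarith) h5

/-- `q₂/(q₂ + nq₀) = α(y) = 2/(3(1−y²))`. [this work] -/
theorem soloInformed_t3_alpha_eq {y : ℝ} (hy : 1 < 3 * y ^ 2) (hy' : y ^ 2 < 1) :
    soloInformedT3q2 y / (soloInformedT3q2 y + soloInformedT3n y * soloInformedT3q0 y) =
      soloInformedT3alpha y := by
  have hy0 : y ≠ 0 := by rintro rfl; norm_num at hy
  have hres := soloInformed_t3_res hy hy'
  have h1 : 1 - y ^ 2 ≠ 0 := by linarith
  have h3 : 3 * (1 - y ^ 2) ≠ 0 := mul_ne_zero (by norm_num) h1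
  rw [div_eq_iff hres, soloInformed_t3_res_eq hy0]
  unfold soloInformedT3q2 soloInformedT3alpha
  field_simp
  ring

/-! ### Algebraicity and semialgebraicity -/

/-- `m, n, a, b, q₀, q₂, α ∈ ℚ(y)` are algebraic for algebraic `y`. [folklore] -/
theorem soloInformed_t3_isAlgebraic {y : ℝ} (hya : IsAlgebraic ℚ y) :
    IsAlgebraic ℚ (soloInformedT3m y) ∧ IsAlgebraic ℚ (soloInformedT3n y) ∧
      IsAlgebraic ℚ (soloInformedT3a y) ∧ IsAlgebraic ℚ (soloInformedT3b y) ∧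
      IsAlgebraic ℚ (soloInformedT3q0 y) ∧ IsAlgebraic ℚ (soloInformedT3q2 y) ∧
      IsAlgebraic ℚ (soloInformedT3alpha y) := by
  have hs : y ∈ algebraicClosure ℚ ℝ := mem_algebraicClosure_iff.2 hya
  have hN : ∀ k : ℕ, (k : ℝ) ∈ algebraicClosure ℚ ℝ := fun k => natCast_mem _ k
  have h2 : (2:ℝ) ∈ algebraicClosure ℚ ℝ := by exact_mod_cast hN 2
  have h3 : (3:ℝ) ∈ algebraicClosure ℚ ℝ := by exact_mod_cast hN 3
  have h4 : (4:ℝ) ∈ algebraicClosure ℚ ℝ := by exact_mod_cast hN 4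
  have h16 : (16:ℝ) ∈ algebraicClosure ℚ ℝ := by exact_mod_cast hN 16
  refine ⟨mem_algebraicClosure_iff.1 ?_, mem_algebraicClosure_iff.1 ?_, mem_algebraicClosure_iff.1 ?_,
    mem_algebraicClosure_iff.1 ?_, mem_algebraicClosure_iff.1 ?_, mem_algebraicClosure_iff.1 ?_,
    mem_algebraicClosure_iff.1 ?_⟩
  · unfold soloInformedT3m; apply_rules (transparency := .reducible) (maxDepth := 250) only
      [pow_mem, div_mem, mul_mem, sub_mem, add_mem, one_mem, hs, h2, h3, h4, h16]
  · unfold soloInformedT3n; apply_rules (transparency := .reducible) (maxDepth := 250) only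
      [pow_mem, div_mem, mul_mem, sub_mem, add_mem, one_mem, hs, h2, h3, h4, h16]
  · unfold soloInformedT3a; apply_rules (transparency := .reducible) (maxDepth := 250) only
      [pow_mem, div_mem, mul_mem, sub_mem, add_mem, one_mem, hs, h2, h3, h4, h16]
  · unfold soloInformedT3b; apply_rules (transparency := .reducible) (maxDepth := 250) only
      [pow_mem, div_mem, mul_mem, sub_mem, add_mem, one_mem, hs, h2, h3, h4, h16]
  · unfold soloInformedT3q0; apply_rules (transparency := .reducible) (maxDepth := 250) only
      [pow_mem, div_mem, mul_mem, sub_mem, add_mem, one_mem, hs, h2, h3, h4, h16]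
  · unfold soloInformedT3q2; apply_rules (transparency := .reducible) (maxDepth := 250) only
      [pow_mem, div_mem, mul_mem, sub_mem, add_mem, one_mem, neg_mem, hs, h2, h3, h4, h16]
  · unfold soloInformedT3alpha; apply_rules (transparency := .reducible) (maxDepth := 250) only
      [pow_mem, div_mem, mul_mem, sub_mem, add_mem, one_mem, hs, h2, h3, h4, h16]

/-- `A(y, wᵢ)`, `B(y, wᵢ)`, `R(y, wᵢ) = (1−mwᵢ²)(1−nwᵢ²)²` are `ℚ`-semialgebraic (algebraic `y`).
[this work] -/
theorem soloInformed_t3_sa {S : Set (Fin 2 → ℝ)} (hS : IsSemialgebraic ℚ S) {y : ℝ}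
    (hya : IsAlgebraic ℚ y) (i : Fin 2) :
    IsSemialgebraicFunOn ℚ S (fun w => soloInformedT3A y (w i)) ∧
    IsSemialgebraicFunOn ℚ S (fun w => soloInformedT3B y (w i)) ∧
    IsSemialgebraicFunOn ℚ S (fun w => (1 - soloInformedT3m y * w i ^ 2) *
      (1 - soloInformedT3n y * w i ^ 2) ^ 2) := by
  obtain ⟨hm, hn, ha, hb, -, -, -⟩ := soloInformed_t3_isAlgebraic hya
  have ht : IsSemialgebraicFunOn ℚ S (fun w => w i) := isSemialgebraicFunOn_apply hS i
  have hA1 := SoloInformedPellAbel.sa_quad hS isAlgebraic_one hm.neg i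
  have hA2 := SoloInformedPellAbel.sa_quad hS isAlgebraic_one ha i
  have hN2 := SoloInformedPellAbel.sa_quad hS isAlgebraic_one hn.neg i
  have hbc : IsSemialgebraicFunOn ℚ S (fun _ => soloInformedT3b y) :=
    isSemialgebraicFunOn_const_of_isAlgebraic hS hb
  refine ⟨(IsSemialgebraicFunOn.mul_holds hA1 hA2).congr fun w _ => ?_,
    (IsSemialgebraicFunOn.mul_holds hbc ht).congr fun w _ => ?_,
    (IsSemialgebraicFunOn.mul_holds hA1 (IsSemialgebraicFunOn.mul_holds hN2 hN2)).congr
      fun w _ => ?_⟩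
  · simp only [Pi.mul_apply, soloInformedT3A]; ring
  · simp only [Pi.mul_apply, soloInformedT3B]
  · simp only [Pi.mul_apply]; ring

end Summit.KontsevichZagierPeriods.KontsevichZagierPeriods.Theorems

end
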